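import Mathlib
import Literature.NumberTheory.Transcendental.ZagierDilogarithmConjecture
import Summits.KontsevichZagierPeriods.KontsevichZagierPeriods.Theorems.HyperbolicBlochTetraSector
import HarnessLib

/-!
# `ZagierDilogarithmConjecture` (stmt-KontsevichZagierPeriods-10550) — line
`kummer-clausen-linearisation`, stub `stub_explainedToKZ`

**Transfer: explained formal combinations are KZ relations.** What the route's deciding theorem
`closes` consumes from Zagier's dilogarithm conjecture is TetraSector's conclusion: for the standard
KZ representations `ρ z = [T(z), t⁻³]` on the ideal tetrahedra with shapes `zᵢ ∈ ℍ⁺`,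
`Σ nᵢ[ρ zᵢ] ∈ KZ.relations`. This file isolates the purely algebraic second half of every sub-sector
theorem of the line: if `Σ nᵢ[zᵢ]` (all `Im zᵢ > 0`) lies in the subgroup of `FreeAbelianGroup ℂ`
generated by `dilogRelators` (five-term instances over `ℚ̄`, `[w] + [w̄]` for algebraic `w`, `[w]` for
real `w`), then `Σ nᵢ[ρ zᵢ] ∈ KZ.relations`. No volume, Dehn-invariant, Galois or algebraicity
hypothesis on the `zᵢ` is needed — algebraicity is carried by the relators themselves.

Proof (as in `SectorReduction.sectorReduction_proof`): lift the sign-corrected class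
`B w = [ρ w]` (`Im w > 0`), `−[ρ w̄]` (`Im w < 0`), `0` (`w` real) to
`φ : FreeAbelianGroup ℂ →+ KZ.FormalRep` (`FreeAbelianGroup.lift`); `φ` maps five-term relators into
`KZ.relations` by the PROVED five-term transfer theorem `FiveTerm.FiveTermTransfer_of`, and the
relators `[w] + [w̄]`, `[w]` (`w` real) to `0` (`SectorReduction.B_add_B_conj_eq_zero`,
`SectorReduction.B_eq_zero_of_im_eq_zero`), so `closure dilogRelators ≤ comap φ KZ.relations`
(`AddSubgroup.closure_le`); finally `φ (Σ nᵢ[zᵢ]) = Σ nᵢ[ρ zᵢ]` because every `zᵢ` lies in the upper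
half plane. Sorry-free; axioms ⊆ {propext, Classical.choice, Quot.sound}.
[cite: KontsevichZagier2001, §1.2] [cite: Neumann1998, §2.1]
-/

noncomputable section

open scoped BigOperators ComplexConjugate
open Literature.NumberTheory.Transcendental

namespace Summit.KontsevichZagierPeriods.HyperbolicBloch.ZagierDilogarithmCertificate

/-- **Transfer of explained combinations to the KZ calculus** (stub `stub_explainedToKZ` of line
`kummer-clausen-linearisation`): for the standard tetrahedral representations `ρ`, a formal
combination `Σ nᵢ[zᵢ]` of shapes in `ℍ⁺` lying in the subgroup generated by `dilogRelators` has
`Σ nᵢ[ρ zᵢ] ∈ KZ.relations`. Pure algebra over the PROVED five-term transfer theorem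
`FiveTerm.FiveTermTransfer_of`: lift the sign-corrected class `B` to
`FreeAbelianGroup ℂ →+ KZ.FormalRep` and check the three relator families.
[cite: KontsevichZagier2001, §1.2] [cite: Neumann1998, §2.1] -/
theorem stub_explainedToKZ :
    ∀ (T : ℂ → Set (Fin 3 → ℝ)), (∀ z, T z = {p | 0 < p 1 ∧ z.re * p 1 < z.im * p 0 ∧
      z.im * (p 0 - 1) < (z.re - 1) * p 1 ∧ 0 < p 2 ∧
      0 < z.im * (p 0 ^ 2 + p 1 ^ 2 + p 2 ^ 2 - p 0) + (z.re - Complex.normSq z) * p 1}) →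
    ∀ (ρ : ℂ → KZ.IntegralRep 3), (∀ z, IsAlgebraic ℚ z → 0 < z.im →
      (ρ z).domain = T z ∧ Set.EqOn (ρ z).integrand (fun p => 1 / p 2 ^ 3) (T z)) →
    ∀ (k : ℕ) (z : Fin k → ℂ) (n : Fin k → ℤ), (∀ i, 0 < (z i).im) →
      (∑ i, n i • FreeAbelianGroup.of (z i)) ∈ AddSubgroup.closure dilogRelators →
        (∑ i, n i • KZ.of (ρ (z i))) ∈ KZ.relations := by
  intro T hT ρ hρ k z n him hmem
  -- (1) the sign-corrected class and its additive extension
  obtain ⟨B, hB⟩ : ∃ B : ℂ → KZ.FormalRep, ∀ w, B w = if 0 < w.im then KZ.of (ρ w)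
      else if w.im < 0 then -KZ.of (ρ (conj w)) else 0 := ⟨_, fun _ => rfl⟩
  let φ : FreeAbelianGroup ℂ →+ KZ.FormalRep := FreeAbelianGroup.lift B
  have hφ : ∀ w, φ (FreeAbelianGroup.of w) = B w := fun w => FreeAbelianGroup.lift_apply_of _ _
  -- (2) every relator is mapped into `KZ.relations` (`FiveTermTransfer_of` for the five-term family)
  have hle : AddSubgroup.closure dilogRelators ≤ KZ.relations.comap φ := by
    rw [AddSubgroup.closure_le]
    rintro c ((⟨x, y, hx, hy, hx0, hx1, hy0, hy1, hxy, rfl⟩ | ⟨w, -, rfl⟩) | ⟨w, hw, rfl⟩)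
    · simp only [SetLike.mem_coe, AddSubgroup.mem_comap, map_add, map_sub, hφ]
      exact FiveTerm.FiveTermTransfer_of T hT ρ hρ B hB x y hx hy hx0 hx1 hy0 hy1 hxy
    · simp only [SetLike.mem_coe, AddSubgroup.mem_comap, map_add, hφ]
      rw [SectorReduction.B_add_B_conj_eq_zero ρ B hB w]
      exact zero_mem _
    · simp only [SetLike.mem_coe, AddSubgroup.mem_comap, hφ]
      rw [SectorReduction.B_eq_zero_of_im_eq_zero ρ B hB w hw]
      exact zero_mem _
  -- (3) the image of `Σ nᵢ [zᵢ]` is `Σ nᵢ [ρ zᵢ]`, every `zᵢ` lying in the upper half plane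
  have hφsum : φ (∑ i, n i • FreeAbelianGroup.of (z i)) = ∑ i, n i • KZ.of (ρ (z i)) := by
    rw [map_sum]
    refine Finset.sum_congr rfl fun i _ => ?_
    rw [map_zsmul, hφ, hB, if_pos (him i)]
  have h2 : (∑ i, n i • FreeAbelianGroup.of (z i)) ∈ KZ.relations.comap φ := hle hmem
  rwa [AddSubgroup.mem_comap, hφsum] at h2

end Summit.KontsevichZagierPeriods.HyperbolicBloch.ZagierDilogarithmCertificate

end
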